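import Literature.AlgebraicGeometry.ShimuraVarieties.UnitaryShimuraCurveSourceClauses
import Literature.AlgebraicGeometry.ShimuraVarieties.UnitaryBallSubBallMorphism
import Literature.AlgebraicGeometry.HodgeTheory.ComplexConjugationHolds
import Literature.NumberTheory.Transcendental.AnalytificationMorphismsProofs
import HarnessLib

/-!
# The embedding `Sh(U(J⋆), 𝔻) → Sh(U(H), 𝔹²)` is a morphism of the COMPLEX fibres ([Milne 2005] §13 p. 118 L25–26 /
# [Liu 2021] proof of Thm. 4.15, «the morphism `Sh(G⋆, h⋆) → Sh(G, h)`», complex half)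

Topic `AlgebraicGeometry/ShimuraVarieties`, namespace `…ShimuraVarieties.UnitaryCanonicalModel`. THEOREMS ONLY (no definition,
no named fact, no instance, no `sorry`).  SOURCE = the curve record system ★ `RecordSystemGS L J⋆ τ K₀⋆` (`U(J⋆)`, pieces =
compact DISC quotients `UnitaryBallUniformisationDatum 1`), TARGET = the rank-3 record system ★ `RecordSystem L H τ T hT K₀`
(`U(H)`, pieces = compact BALL quotients `UnitaryBallUniformisationDatum 2`), along the frame `ᵗ(cB)·(a·H)·B = J⋆ ⊕ J⊥`
(`τ a` a positive real) and `φGS = R_B ∘ (· ⊕ 1)` with `φGS(K⋆) ≤ K`.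

**Main theorem `RecordSystemGS.exists_embeddingComplex`**: there is a morphism `ι_ℂ : (M⋆_{K⋆})_τ → (M_K)_τ` of the complex
fibres over `ℂ` acting on complex points as the sub-ball inclusion ★ `ShimuraSetGS.embPoints`, `[v, uK⋆] ↦ [𝔹(B^τ(v ⊕ 0)), φGS(u)K]`
— EXACTLY the hypothesis `hC` of ★ `RecordSystemGS.embeddingDefinedOver_of_complex` (A-p08, `UnitaryShimuraCurveEmbeddingDescent`),
so that the conjunct u2 `S⋆.EmbeddingDefinedOver S …` of ★ `exists_recordSystemGS` is a THEOREM for every pair of records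
(`RecordSystemGS.embeddingDefinedOver`, when that file is in the tree — here only the complex half).

Proof = ★ `UnitaryShimuraHeckeComplex.exists_heckeComplex` with two records: on the source piece `Y_q = Γ⋆_q∖𝔻` (representative
`g⋆_q`), choose the target class `q'` of `φGS(g⋆_q)` and a bookkeeper `γ_q ∈ U(H)(L⁺)` with `g_{q'}⁻¹ γ_{q,f} φGS(g⋆_q) ∈ K`
(★ `exists_rational_smul_rep_mem`); the piece map is the sub-ball translation along the isometric `3 × 2` matrix
`M_q = √(re τa) · τ((γ_q B)·(e₁|e₂))` (★ `source_gram`, ★ `source_group` of `UnitaryShimuraCurveSourceClauses`), a `ℂ`-MORPHISM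
`Y_q ⟶ X_{q'}` by ★ `UnitaryBallSubBallMorphism.exists_hom_map_unif_mulVec_eq_of_gram` (holomorphy through local sections of the
disc uniformisation, local injectivity from the target's discontinuity, Arapura Cor. 15.4.6 = ★ `arapura2012_cor_15_4_6_holds`,
Hodge models from ★ `exists_isReal_hodgeModel_holds`); the pieces glue along the source cofan (`Cofan.IsColimit.desc`), and the
point formula is checked piece by piece (`[v, uK⋆] = [δ^τ v, g⋆_q K⋆]`, ★ `embPoints_mk`, the γ-move
`[𝔹(w), φGS(g⋆_q)K] = [𝔹(γ^τ w), g_{q'}K]`, and the target `pieces` clause).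

## References
* [Milne2005ShimuraVarieties] J. S. Milne, *Introduction to Shimura varieties* (2005; rev. 2017), Thm. 5.16 / (5.1) p. 56,
  Lemma 5.13 p. 57, §13 Thm. 13.6 p. 118 L21–28 («`T(g)` is a morphism … because of Theorem 3.14»), Rem. 13.8.
* [Liu2021] Y. Liu, Camb. J. Math. 9 (2021), proof of Thm. 4.15 (FJcycle.tex l. 2193–2208).
* [Deligne1979ShimuraVarieties] P. Deligne, *Variétés de Shimura* (1979), 2.1.2–2.1.4.
* [BergeronMillsonMoeglin2016Balls] N. Bergeron, J. Millson, C. Moeglin, Acta Math. 216 (2016), Part 2 §§3.1–3.3.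
* [Arapura2012] D. Arapura, *Algebraic Geometry over the Complex Numbers* (2012), Cor. 15.4.6.
-/

set_option autoImplicit false

noncomputable section

open Function MulAction Topology NumberField IsDedekindDomain CategoryTheory CategoryTheory.Limits Matrix AlgebraicGeometry
open scoped Matrix ComplexOrder
open Literature.AlgebraicGeometry.Motives
open Literature.NumberTheory.Automorphic Literature.NumberTheory.Automorphic.UnitaryGroup
open Literature.NumberTheory.Automorphic.Liu2021.AppendixC (C5.OpenCompactSubgroup C5.SmallLevel)
open Literature.Geometry.ComplexHyperbolic Literature.Geometry.ComplexHyperbolic.BallModel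
open Literature.NumberTheory.Automorphic.ShimuraDissection
open Literature.AlgebraicGeometry.HodgeTheory (HodgeModel)
open Literature.NumberTheory.Transcendental (arapura2012_cor_15_4_6_holds)

namespace Literature.AlgebraicGeometry.ShimuraVarieties.UnitaryCanonicalModel

variable {L : Type} [Field L] [NumberField L] [IsCMField L] {Jstar : Matrix (Fin 2) (Fin 2) L} {τ : L →+* ℂ}
  {K₀ : C5.OpenCompactSubgroup ↥(finAdelic (↥(maximalRealSubfield L)) L (IsCMField.complexConj L) 2 Jstar)}
  {H : Matrix (Fin 3) (Fin 3) L} {T : GL (Fin 3) ℂ} {hT : formCongr (starRingEnd ℂ) T (H.map τ) = BallModel.J}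
  {K₀' : C5.OpenCompactSubgroup ↥(finAdelic (↥(maximalRealSubfield L)) L (IsCMField.complexConj L) 3 H)}

/-! ### §1. Algebra helpers (twins of the private helpers of ★ `UnitaryShimuraCurveSourceClauses`) -/

omit [NumberField L] [IsCMField L] in
/-- The column shape of the frame embedding read through `τ`: `τ(B′·(e₁|e₂))·v = B′^τ(v ⊕ 0) = frameEmbNeg τ B′ v`.
[cite: Kudla1984, §1] -/
private theorem submatrix_map_mulVec_eq_frameEmbNeg' (B' : GL (Fin 3) L) (v : Fin 2 → ℂ) :
    (((B' : Matrix (Fin 3) (Fin 3) L).submatrix id Fin.castSucc).map τ) *ᵥ v = frameEmbNeg τ B' v := by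
  rw [show (((B' : Matrix (Fin 3) (Fin 3) L).submatrix id Fin.castSucc).map τ) =
      (((B' : Matrix (Fin 3) (Fin 3) L).map τ).submatrix id Fin.castSucc) from rfl, submatrix_castSucc_mulVec]
  rfl

omit [NumberField L] [IsCMField L] in
/-- `frameEmbNeg` along a translated frame: `(γB)^τ(v ⊕ 0) = γ^τ · B^τ(v ⊕ 0)`. [cite: Kudla1984, §1] -/
private theorem frameEmbNeg_mul' (γ B : GL (Fin 3) L) (v : Fin 2 → ℂ) :
    frameEmbNeg τ (γ * B) v = ((γ : Matrix (Fin 3) (Fin 3) L).map τ) *ᵥ frameEmbNeg τ B v := by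
  unfold frameEmbNeg
  rw [Units.val_mul, Matrix.map_mul, mulVec_mulVec]

omit [NumberField L] [IsCMField L] in
/-- `𝔹` depends only on the vector (proof-irrelevance helper). [folklore] -/
private theorem negConeToBall_congr'' (hT : formCongr (starRingEnd ℂ) T (H.map τ) = BallModel.J) {v w : Fin 3 → ℂ}
    (hv : v ∈ negCone (H.map τ)) (hw : w ∈ negCone (H.map τ)) (h : v = w) :
    negConeToBall hT hv = negConeToBall hT hw := by
  subst h; rfl

/-! ### §2. The piece morphism: the source disc quotient maps into the target ball quotient along `M_q` -/

section Piece

variable (Jperp : Matrix (Fin 1) (Fin 1) L) (B : GL (Fin 3) L) {a : L} (ha : a ≠ 0)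
  (hB : formCongr ((IsCMField.complexConj L : L ≃ₐ[↥(maximalRealSubfield L)] L) : L →+* L) B (a • H) = finSum 2 1 Jstar Jperp)
  (hτa : 0 < (τ a).re) (hτa' : (τ a).im = 0)
  {Kstar : C5.SmallLevel K₀} {K : C5.SmallLevel K₀'}
  (hK : Kstar.1.1.map (φGS L Jstar Jperp H B ha hB) ≤ K.1.1)
  {Xq : SchemeOver ℂ} (Bq : UnitaryBallUniformisationDatum 2 Xq) (gq : finAdelic (↥(maximalRealSubfield L)) L (IsCMField.complexConj L) 3 H)
  {Y : SchemeOver ℂ} (D₁ : UnitaryBallUniformisationDatum 1 Y)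
  (gs : finAdelic (↥(maximalRealSubfield L)) L (IsCMField.complexConj L) 2 Jstar)
  (γ : ↥(rational (↥(maximalRealSubfield L)) L (IsCMField.complexConj L) 3 H))

include hB hτa hτa' hK in
/-- **The piece morphism.**  For a source piece `(Y, D₁)` with `D₁.Hℂ = J⋆^τ`, `D₁.Γ^{τ₁} = Γ_{J⋆}(g⋆ K⋆ g⋆⁻¹)^τ`, a target piece
`(X_q, B_q)` with `B_q.Hℂ = H^τ`, `B_q.Γ^{τ₁} = Γ_H(g_q K g_q⁻¹)^τ`, and a bookkeeper `γ` with `g_q⁻¹ γ_f φGS(g⋆) ∈ K`: there is a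
`ℂ`-morphism `f : Y ⟶ X_q` with `f(ℂ)(unif₁ v) = unif_q((γB)^τ(v ⊕ 0))` on the negative cone of `J⋆^τ` — ★
`UnitaryBallSubBallMorphism.exists_hom_map_unif_mulVec_eq_of_gram` at `M = √(re τa)·τ((γB)·(e₁|e₂))` (★ `source_gram`, ★ `source_group`),
Arapura ★ `arapura2012_cor_15_4_6_holds`, Hodge models ★ `exists_isReal_hodgeModel_holds`.
[cite: Milne2005ShimuraVarieties, §13 p. 118 L21–28] [cite: BergeronMillsonMoeglin2016Balls, Part 2 §§3.1–3.3] [cite: Arapura2012, §15.4 Cor. 15.4.6] -/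
theorem exists_hom_piece_subBall (hBq : Bq.Hℂ = H.map τ)
    (hΓq : Bq.Γ.map (Matrix.GeneralLinearGroup.map (Bq.τ₁ : ↥Bq.E →+* ℂ)) =
      (arithmeticLevel (↥(maximalRealSubfield L)) L (IsCMField.complexConj L) 3 H
        (K.1.1.map (MulAut.conj gq).toMonoidHom)).map (Matrix.GeneralLinearGroup.map τ))
    (hD₁ : D₁.Hℂ = Jstar.map τ)
    (hΓ₁ : D₁.Γ.map (Matrix.GeneralLinearGroup.map (D₁.τ₁ : ↥D₁.E →+* ℂ)) =
      (arithmeticLevel (↥(maximalRealSubfield L)) L (IsCMField.complexConj L) 2 Jstar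
        (Kstar.1.1.map (MulAut.conj gs).toMonoidHom)).map (Matrix.GeneralLinearGroup.map τ))
    (hγ : gq⁻¹ * (rationalToFinAdelic (↥(maximalRealSubfield L)) L (IsCMField.complexConj L) 3 H γ *
      φGS L Jstar Jperp H B ha hB gs) ∈ K.1.1) :
    ∃ f : Y ⟶ Xq, ∀ v ∈ negCone (Jstar.map τ),
      AlgPoints.map f (D₁.unif v) = Bq.unif (frameEmbNeg τ ((γ : GL (Fin 3) L) * B) v) := by
  set M : Matrix (Fin 3) (Fin 2) ℂ :=
    (Real.sqrt (τ a).re : ℂ) • ((((γ : GL (Fin 3) L) * B : GL (Fin 3) L) : Matrix (Fin 3) (Fin 3) L).submatrix id Fin.castSucc).map τ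
    with hMdef
  -- gram and group clauses (★ `UnitaryShimuraCurveSourceClauses` §3)
  have hgram : Mᴴ * Bq.Hℂ * M = D₁.Hℂ := by
    rw [hBq, hMdef]
    exact source_gram Jperp B hB hτa hτa' D₁ γ hD₁
  have hgroup0 := source_group Jperp B ha hB hK gq D₁ gs γ hΓ₁ hγ
  have hgroup : ∀ γ₁ ∈ D₁.Γ, ∃ γ₂ ∈ Bq.Γ,
      ((γ₂ : GL (Fin 3) Bq.E) : Matrix (Fin 3) (Fin 3) Bq.E).map Bq.τ₁ * M =
        M * ((γ₁ : GL (Fin 2) D₁.E) : Matrix (Fin 2) (Fin 2) D₁.E).map D₁.τ₁ := by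
    intro γ₁ hγ₁
    obtain ⟨γ', hγ', hγ'M⟩ := hgroup0 γ₁ hγ₁
    -- `γ'^τ ∈ B_q.Γ^{τ₁}`
    have hmem : Matrix.GeneralLinearGroup.map τ γ' ∈ Bq.Γ.map (Matrix.GeneralLinearGroup.map (Bq.τ₁ : ↥Bq.E →+* ℂ)) := by
      rw [hΓq]; exact Subgroup.mem_map_of_mem _ hγ'
    obtain ⟨γ₂, hγ₂, hγ₂eq⟩ := Subgroup.mem_map.1 hmem
    refine ⟨γ₂, hγ₂, ?_⟩
    have hmat : ((γ₂ : GL (Fin 3) Bq.E) : Matrix (Fin 3) (Fin 3) Bq.E).map Bq.τ₁ = (γ' : Matrix (Fin 3) (Fin 3) L).map τ := by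
      have := congrArg (fun g : GL (Fin 3) ℂ => (g : Matrix (Fin 3) (Fin 3) ℂ)) hγ₂eq
      exact this
    rw [hmat, hMdef]
    exact hγ'M
  -- Hodge models, and the sub-ball morphism
  have hA₁ : Nonempty (HodgeModel 1 Y) :=
    let ⟨A, _⟩ := HodgeTheory.exists_isReal_hodgeModel_holds 1 Y D₁.isSmoothProjective; ⟨A⟩
  have hA₂ : Nonempty (HodgeModel 2 Xq) :=
    let ⟨A, _⟩ := HodgeTheory.exists_isReal_hodgeModel_holds 2 Xq Bq.isSmoothProjective; ⟨A⟩
  obtain ⟨f, hf⟩ := UnitaryBallSubBallMorphism.exists_hom_map_unif_mulVec_eq_of_gram arapura2012_cor_15_4_6_holds hA₁ hA₂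
    hgram hgroup
  refine ⟨f, fun v hv => ?_⟩
  have hv' : v ∈ D₁.cone := by change v ∈ negCone D₁.Hℂ; rw [hD₁]; exact hv
  have hγB : formCongr ((IsCMField.complexConj L : L ≃ₐ[↥(maximalRealSubfield L)] L) : L →+* L) ((γ : GL (Fin 3) L) * B) (a • H) =
      finSum 2 1 Jstar Jperp := by rw [formCongr_mul_of_mem_rational γ B a]; exact hB
  have hw' : frameEmbNeg τ ((γ : GL (Fin 3) L) * B) v ∈ Bq.cone := by
    change _ ∈ negCone Bq.Hℂ; rw [hBq]; exact frameEmbNeg_mem_negCone τ hγB hτa hτa' hv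
  have hr : (Real.sqrt (τ a).re : ℂ) ≠ 0 := by
    rw [Ne, Complex.ofReal_eq_zero]; exact (Real.sqrt_pos.2 hτa).ne'
  have hMv : M *ᵥ v = (Real.sqrt (τ a).re : ℂ) • frameEmbNeg τ ((γ : GL (Fin 3) L) * B) v := by
    rw [hMdef, Matrix.smul_mulVec, submatrix_map_mulVec_eq_frameEmbNeg']
  rw [hf v hv', hMv, Bq.unif_smul hr hw']

end Piece

/-! ### §3. Point bookkeeping on the two Shimura sets -/

section Points

/-- `ShimuraSetGS.mk` depends only on the vector (proof-irrelevance helper). [folklore] -/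
private theorem ShimuraSetGS.mk_congr_vec {Kc : Subgroup ↥(finAdelic (↥(maximalRealSubfield L)) L (IsCMField.complexConj L) 2 Jstar)}
    {v v' : Fin 2 → ℂ} (hv : v ∈ negCone (Jstar.map τ)) (hv' : v' ∈ negCone (Jstar.map τ)) (h : v = v')
    (a : ↥(finAdelic (↥(maximalRealSubfield L)) L (IsCMField.complexConj L) 2 Jstar)) :
    ShimuraSetGS.mk L Jstar τ Kc v hv a = ShimuraSetGS.mk L Jstar τ Kc v' hv' a := by
  subst h; rfl

/-- **Moving a point of `Sh_{K⋆}(ℂ)` to the piece of its class**: if `(δ_f u)⁻¹ g⋆ ∈ K⋆` (`δ ∈ U(J⋆)(L⁺)`, ★ `exists_rational_smul_rep_mem`)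
then `[v, uK⋆] = [δ^τ v, g⋆ K⋆]` (★ `ShimuraSetGS.mk_smul_mulVec` with `c = 1`, then ★ `ShimuraSetGS.mk_mul_of_mem`).
[cite: Milne2005ShimuraVarieties, Lemma 5.13 p. 57] -/
theorem ShimuraSetGS.mk_eq_mk_mulVec_rep {Kc : Subgroup ↥(finAdelic (↥(maximalRealSubfield L)) L (IsCMField.complexConj L) 2 Jstar)}
    (v : Fin 2 → ℂ) (hv : v ∈ negCone (Jstar.map τ))
    (u gs : ↥(finAdelic (↥(maximalRealSubfield L)) L (IsCMField.complexConj L) 2 Jstar))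
    (δ : ↥(rational (↥(maximalRealSubfield L)) L (IsCMField.complexConj L) 2 Jstar))
    (hδ : (rationalToFinAdelic (↥(maximalRealSubfield L)) L (IsCMField.complexConj L) 2 Jstar δ * u)⁻¹ * gs ∈ Kc)
    (hx : ((ratToGLℂ L Jstar τ δ : GL (Fin 2) ℂ) : Matrix (Fin 2) (Fin 2) ℂ) *ᵥ v ∈ negCone (Jstar.map τ)) :
    ShimuraSetGS.mk L Jstar τ Kc v hv u =
      ShimuraSetGS.mk L Jstar τ Kc (((ratToGLℂ L Jstar τ δ : GL (Fin 2) ℂ) : Matrix (Fin 2) (Fin 2) ℂ) *ᵥ v) hx gs := by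
  have h1 : (1 : ℂ) • (((ratToGLℂ L Jstar τ δ : GL (Fin 2) ℂ) : Matrix (Fin 2) (Fin 2) ℂ) *ᵥ v) ∈ negCone (Jstar.map τ) :=
    smul_ratToGLℂ_mulVec_mem_negCone (L := L) (Jstar := Jstar) (τ := τ) δ one_ne_zero hv
  -- `k := g⋆⁻¹ δ_f u ∈ K⋆` and `δ_f u = g⋆ k`
  have hk : gs⁻¹ * (rationalToFinAdelic (↥(maximalRealSubfield L)) L (IsCMField.complexConj L) 2 Jstar δ * u) ∈ Kc := by
    have h := Kc.inv_mem hδ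
    rwa [_root_.mul_inv_rev, inv_inv] at h
  have hgk : rationalToFinAdelic (↥(maximalRealSubfield L)) L (IsCMField.complexConj L) 2 Jstar δ * u =
      gs * (gs⁻¹ * (rationalToFinAdelic (↥(maximalRealSubfield L)) L (IsCMField.complexConj L) 2 Jstar δ * u)) := by
    rw [mul_inv_cancel_left]
  rw [← ShimuraSetGS.mk_smul_mulVec L Jstar τ Kc δ one_ne_zero v hv h1 u, hgk, ShimuraSetGS.mk_mul_of_mem L Jstar τ Kc _ h1 gs hk]
  exact ShimuraSetGS.mk_congr_vec h1 hx (one_smul _ _) gs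

variable (S : RecordSystem L H τ T hT K₀')
  (Jperp : Matrix (Fin 1) (Fin 1) L) (B : GL (Fin 3) L) {a : L} (ha : a ≠ 0)
  (hB : formCongr ((IsCMField.complexConj L : L ≃ₐ[↥(maximalRealSubfield L)] L) : L →+* L) B (a • H) = finSum 2 1 Jstar Jperp)
  (hτa : 0 < (τ a).re) (hτa' : (τ a).im = 0)
  {Kstar : C5.SmallLevel K₀} {K : C5.SmallLevel K₀'}
  (hK : Kstar.1.1.map (φGS L Jstar Jperp H B ha hB) ≤ K.1.1)
  {Xq : SchemeOver ℂ} (Bq : UnitaryBallUniformisationDatum 2 Xq) (gq : finAdelic (↥(maximalRealSubfield L)) L (IsCMField.complexConj L) 3 H)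
  (gs : finAdelic (↥(maximalRealSubfield L)) L (IsCMField.complexConj L) 2 Jstar)
  (γ : ↥(rational (↥(maximalRealSubfield L)) L (IsCMField.complexConj L) 3 H))

/-- **The embedded point in target-piece coordinates**: `embPoints [x, g⋆ K⋆] = [𝔹(B^τ(x ⊕ 0)), φGS(g⋆)K] = [𝔹((γB)^τ(x ⊕ 0)), g_q K]`
for a bookkeeper `γ` with `g_q⁻¹ γ_f φGS(g⋆) ∈ K` (★ `embPoints_mk`, the γ-move ★ `ShimuraSet.mk_eq_mk_iff` + ★ `ratToU21_smul_negConeToBall`),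
read through the target piece's uniformisation clause (`𝔹`/`lift_proj`/`unif_smul`) — the two-record bookkeeping of ★
`map_baseChange_emb_map_source_unif`, without its embedding hypothesis. [cite: Milne2005ShimuraVarieties, Lemma 5.13 p. 57 and Thm. 13.6 p. 118]
[cite: Deligne1979ShimuraVarieties, 2.1.2] -/
theorem map_piece_unif_frameEmbNeg_eq_embPoints (hBq : Bq.Hℂ = H.map τ)
    (ιq : Xq ⟶ (Motives.baseChangeHom τ).obj (S.M.obj K))
    (hιq : letI : Algebra L ℂ := τ.toAlgebra
      ∀ x : Ball, AlgPoints.map (L := ℂ) ιq (Bq.unif ((T : Matrix (Fin 3) (Fin 3) ℂ) *ᵥ BallModel.lift x)) =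
        AlgPoints.baseChangeEquiv τ (S.M.obj K) ((S.pts K).symm (ShimuraSet.mk L H τ T hT K.1.1 x gq)))
    (hγ : gq⁻¹ * (rationalToFinAdelic (↥(maximalRealSubfield L)) L (IsCMField.complexConj L) 3 H γ *
      φGS L Jstar Jperp H B ha hB gs) ∈ K.1.1)
    (x : Fin 2 → ℂ) (hx : x ∈ negCone (Jstar.map τ)) :
    letI : Algebra L ℂ := τ.toAlgebra
    AlgPoints.map (L := ℂ) ιq (Bq.unif (frameEmbNeg τ ((γ : GL (Fin 3) L) * B) x)) =
      AlgPoints.baseChangeEquiv τ (S.M.obj K) ((S.pts K).symm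
        (ShimuraSetGS.embPoints L H τ T hT Jstar Jperp B ha hB hτa hτa' Kstar.1.1 K.1.1 hK (ShimuraSetGS.mk L Jstar τ Kstar.1.1 x hx gs))) := by
  letI : Algebra L ℂ := τ.toAlgebra
  have hw : frameEmbNeg τ B x ∈ negCone (H.map τ) := frameEmbNeg_mem_negCone τ hB hτa hτa' hx
  have hγB : formCongr ((IsCMField.complexConj L : L ≃ₐ[↥(maximalRealSubfield L)] L) : L →+* L) ((γ : GL (Fin 3) L) * B) (a • H) =
      finSum 2 1 Jstar Jperp := by rw [formCongr_mul_of_mem_rational γ B a]; exact hB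
  have hw' : frameEmbNeg τ ((γ : GL (Fin 3) L) * B) x ∈ negCone (H.map τ) := frameEmbNeg_mem_negCone τ hγB hτa hτa' hx
  have e : ((Matrix.GeneralLinearGroup.map τ ((γ : GL (Fin 3) L)) : GL (Fin 3) ℂ) : Matrix (Fin 3) (Fin 3) ℂ) *ᵥ
      frameEmbNeg τ B x = frameEmbNeg τ ((γ : GL (Fin 3) L) * B) x := by
    rw [frameEmbNeg_mul']; rfl
  have hγw : ((Matrix.GeneralLinearGroup.map τ ((γ : GL (Fin 3) L)) : GL (Fin 3) ℂ) : Matrix (Fin 3) (Fin 3) ℂ) *ᵥ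
      frameEmbNeg τ B x ∈ negCone (H.map τ) := by rw [e]; exact hw'
  -- the γ-move on the target Shimura set
  have hmk : ShimuraSet.mk L H τ T hT K.1.1 (negConeToBall hT hw') gq =
      ShimuraSet.mk L H τ T hT K.1.1 (negConeToBall hT hw) (φGS L Jstar Jperp H B ha hB gs) := by
    rw [ShimuraSet.mk_eq_mk_iff]
    refine ⟨γ, ?_, hγ⟩
    rw [ratToU21_smul_negConeToBall hT γ hw hγw]
    exact negConeToBall_congr'' hT hγw hw' e
  -- the target piece through `gq`, at the ball point of `(γB)^τ(x ⊕ 0)`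
  have hQ := Q_inv_mulVec_neg_of_mem_negCone hT hw'
  have h2 : ((↑T⁻¹ : Matrix (Fin 3) (Fin 3) ℂ) *ᵥ frameEmbNeg τ ((γ : GL (Fin 3) L) * B) x) 2 ≠ 0 :=
    BallModel.ne_zero_of_Q_neg hQ
  have hlift : (T : Matrix (Fin 3) (Fin 3) ℂ) *ᵥ BallModel.lift (negConeToBall hT hw') =
      (((↑T⁻¹ : Matrix (Fin 3) (Fin 3) ℂ) *ᵥ frameEmbNeg τ ((γ : GL (Fin 3) L) * B) x) 2)⁻¹ •
        frameEmbNeg τ ((γ : GL (Fin 3) L) * B) x := by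
    unfold negConeToBall
    rw [UnitaryBallUniformisationDatum.lift_proj, mulVec_smul, mulVec_mulVec, ← Units.val_mul, mul_inv_cancel,
      Units.val_one, one_mulVec]
  have hwq : frameEmbNeg τ ((γ : GL (Fin 3) L) * B) x ∈ Bq.cone := by
    change _ ∈ negCone Bq.Hℂ; rw [hBq]; exact hw'
  rw [ShimuraSetGS.embPoints_mk, ← hmk, ← hιq, hlift, Bq.unif_smul (inv_ne_zero h2) hwq]

end Points

/-! ### §4. The glued map on complex points -/

section Glue

variable (Sstar : RecordSystemGS L Jstar τ K₀) (S : RecordSystem L H τ T hT K₀')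
  (Jperp : Matrix (Fin 1) (Fin 1) L) (B : GL (Fin 3) L) {a : L} (ha : a ≠ 0)
  (hB : formCongr ((IsCMField.complexConj L : L ≃ₐ[↥(maximalRealSubfield L)] L) : L →+* L) B (a • H) = finSum 2 1 Jstar Jperp)
  (hτa : 0 < (τ a).re) (hτa' : (τ a).im = 0)
  {Kstar : C5.SmallLevel K₀} {K : C5.SmallLevel K₀'} (hK : Kstar.1.1.map (φGS L Jstar Jperp H B ha hB) ≤ K.1.1)

/-- **The glued map on a point of the piece `q`**: with the data of `map_glued_eq_embPoints` below, any `ι_ℂ` with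
`ι⋆_q ≫ ι_ℂ = f_q ≫ ι_{q'}` sends `[x, g⋆_q K⋆]` to `embPoints [x, g⋆_q K⋆]` — cross by `f_q` and read the image in the target piece
(`map_piece_unif_frameEmbNeg_eq_embPoints`). [cite: Milne2005ShimuraVarieties, Lemma 5.13 p. 57 and §13 p. 118 L21–28]
[cite: Deligne1979ShimuraVarieties, 2.1.2–2.1.4] -/
theorem RecordSystemGS.map_glued_mk_rep_eq_embPoints {Ξs Ξ : Type*} {Xs : Ξs → SchemeOver ℂ}
    (ιs : ∀ q, Xs q ⟶ (Motives.baseChangeHom τ).obj (Sstar.M.obj Kstar))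
    (Bs : ∀ q, UnitaryBallUniformisationDatum 1 (Xs q))
    (gs : Ξs → ↥(finAdelic (↥(maximalRealSubfield L)) L (IsCMField.complexConj L) 2 Jstar))
    (hBs : letI : Algebra L ℂ := τ.toAlgebra
      ∀ q (v : Fin 2 → ℂ) (hv : v ∈ negCone (Jstar.map τ)), AlgPoints.map (ιs q) ((Bs q).unif v) =
        AlgPoints.baseChangeEquiv τ (Sstar.M.obj Kstar) ((Sstar.pts Kstar).symm (ShimuraSetGS.mk L Jstar τ Kstar.1.1 v hv (gs q))))
    {X : Ξ → SchemeOver ℂ} (ι : ∀ r, X r ⟶ (Motives.baseChangeHom τ).obj (S.M.obj K))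
    (Bq : ∀ r, UnitaryBallUniformisationDatum 2 (X r)) (gq : Ξ → finAdelic (↥(maximalRealSubfield L)) L (IsCMField.complexConj L) 3 H)
    (hBq : ∀ r, (Bq r).Hℂ = H.map τ)
    (hιq : letI : Algebra L ℂ := τ.toAlgebra
      ∀ r (x : Ball), AlgPoints.map (L := ℂ) (ι r) ((Bq r).unif ((T : Matrix (Fin 3) (Fin 3) ℂ) *ᵥ BallModel.lift x)) =
        AlgPoints.baseChangeEquiv τ (S.M.obj K) ((S.pts K).symm (ShimuraSet.mk L H τ T hT K.1.1 x (gq r))))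
    (q' : Ξs → Ξ) (γ : Ξs → ↥(rational (↥(maximalRealSubfield L)) L (IsCMField.complexConj L) 3 H))
    (hγ : ∀ q, (gq (q' q))⁻¹ * (rationalToFinAdelic (↥(maximalRealSubfield L)) L (IsCMField.complexConj L) 3 H (γ q) *
      φGS L Jstar Jperp H B ha hB (gs q)) ∈ K.1.1)
    (f : ∀ q, Xs q ⟶ X (q' q))
    (hf : ∀ q, ∀ v ∈ negCone (Jstar.map τ),
      AlgPoints.map (f q) ((Bs q).unif v) = (Bq (q' q)).unif (frameEmbNeg τ ((γ q : GL (Fin 3) L) * B) v))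
    (ιc : (Motives.baseChangeHom τ).obj (Sstar.M.obj Kstar) ⟶ (Motives.baseChangeHom τ).obj (S.M.obj K))
    (hιc : ∀ q, ιs q ≫ ιc = f q ≫ ι (q' q))
    (q : Ξs) (x : Fin 2 → ℂ) (hx : x ∈ negCone (Jstar.map τ)) :
    letI : Algebra L ℂ := τ.toAlgebra
    AlgPoints.map ιc (AlgPoints.baseChangeEquiv τ (Sstar.M.obj Kstar)
        ((Sstar.pts Kstar).symm (ShimuraSetGS.mk L Jstar τ Kstar.1.1 x hx (gs q)))) =
      AlgPoints.baseChangeEquiv τ (S.M.obj K) ((S.pts K).symm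
        (ShimuraSetGS.embPoints L H τ T hT Jstar Jperp B ha hB hτa hτa' Kstar.1.1 K.1.1 hK (ShimuraSetGS.mk L Jstar τ Kstar.1.1 x hx (gs q)))) := by
  letI : Algebra L ℂ := τ.toAlgebra
  -- (`rewrite`, not `rw`: the closing `rfl` attempts on these goals are expensive)
  rewrite [← hBs q x hx, ← AlgPoints.map_comp_apply, hιc q, AlgPoints.map_comp_apply, hf q x hx]
  exact map_piece_unif_frameEmbNeg_eq_embPoints S Jperp B ha hB hτa hτa' hK (Bq (q' q)) (gq (q' q)) (gs q) (γ q) (hBq (q' q))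
    (ι (q' q)) (hιq (q' q)) (hγ q) x hx

/-- **The glued map acts as `embPoints`** (the point computation of `exists_embeddingComplex`, stated over abstract index types so that
it elaborates within the default heartbeats): given uniformised source pieces `(Y_q, unif⋆_q, g⋆_q)` of `(M⋆_{K⋆})_τ` whose
classes exhaust `U(J⋆)(𝔸_f)` up to `U(J⋆)(L⁺)` and `K⋆`, uniformised target pieces `(X_r, unif_r, g_r)` of `(M_K)_τ`, an assignment
`q ↦ q'` with bookkeepers `γ_q` (`g_{q'}⁻¹ γ_{q,f} φGS(g⋆_q) ∈ K`) and piece maps `f_q : Y_q ⟶ X_{q'}` with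
`f_q(ℂ)(unif⋆_q v) = unif_{q'}((γ_q B)^τ(v ⊕ 0))`, any `ι_ℂ` with `ι⋆_q ≫ ι_ℂ = f_q ≫ ι_{q'}` (e.g. the glued map `∐ f_q`) sends `[v, uK⋆]` to
`embPoints [v, uK⋆]`: move the point to its piece (`ShimuraSetGS.mk_eq_mk_mulVec_rep`) and apply `map_glued_mk_rep_eq_embPoints`.
[cite: Milne2005ShimuraVarieties, Lemma 5.13 p. 57 and §13 p. 118 L21–28] [cite: Deligne1979ShimuraVarieties, 2.1.2–2.1.4] -/
theorem RecordSystemGS.map_glued_eq_embPoints {Ξs Ξ : Type*} {Xs : Ξs → SchemeOver ℂ}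
    (ιs : ∀ q, Xs q ⟶ (Motives.baseChangeHom τ).obj (Sstar.M.obj Kstar))
    (Bs : ∀ q, UnitaryBallUniformisationDatum 1 (Xs q))
    (gs : Ξs → ↥(finAdelic (↥(maximalRealSubfield L)) L (IsCMField.complexConj L) 2 Jstar))
    (hBs : letI : Algebra L ℂ := τ.toAlgebra
      ∀ q (v : Fin 2 → ℂ) (hv : v ∈ negCone (Jstar.map τ)), AlgPoints.map (ιs q) ((Bs q).unif v) =
        AlgPoints.baseChangeEquiv τ (Sstar.M.obj Kstar) ((Sstar.pts Kstar).symm (ShimuraSetGS.mk L Jstar τ Kstar.1.1 v hv (gs q))))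
    {X : Ξ → SchemeOver ℂ} (ι : ∀ r, X r ⟶ (Motives.baseChangeHom τ).obj (S.M.obj K))
    (Bq : ∀ r, UnitaryBallUniformisationDatum 2 (X r)) (gq : Ξ → finAdelic (↥(maximalRealSubfield L)) L (IsCMField.complexConj L) 3 H)
    (hBq : ∀ r, (Bq r).Hℂ = H.map τ)
    (hιq : letI : Algebra L ℂ := τ.toAlgebra
      ∀ r (x : Ball), AlgPoints.map (L := ℂ) (ι r) ((Bq r).unif ((T : Matrix (Fin 3) (Fin 3) ℂ) *ᵥ BallModel.lift x)) =
        AlgPoints.baseChangeEquiv τ (S.M.obj K) ((S.pts K).symm (ShimuraSet.mk L H τ T hT K.1.1 x (gq r))))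
    (q' : Ξs → Ξ) (γ : Ξs → ↥(rational (↥(maximalRealSubfield L)) L (IsCMField.complexConj L) 3 H))
    (hγ : ∀ q, (gq (q' q))⁻¹ * (rationalToFinAdelic (↥(maximalRealSubfield L)) L (IsCMField.complexConj L) 3 H (γ q) *
      φGS L Jstar Jperp H B ha hB (gs q)) ∈ K.1.1)
    (f : ∀ q, Xs q ⟶ X (q' q))
    (hf : ∀ q, ∀ v ∈ negCone (Jstar.map τ),
      AlgPoints.map (f q) ((Bs q).unif v) = (Bq (q' q)).unif (frameEmbNeg τ ((γ q : GL (Fin 3) L) * B) v))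
    (ιc : (Motives.baseChangeHom τ).obj (Sstar.M.obj Kstar) ⟶ (Motives.baseChangeHom τ).obj (S.M.obj K))
    (hιc : ∀ q, ιs q ≫ ιc = f q ≫ ι (q' q))
    (hgs : ∀ u : ↥(finAdelic (↥(maximalRealSubfield L)) L (IsCMField.complexConj L) 2 Jstar),
      ∃ (q : Ξs) (δ : ↥(rational (↥(maximalRealSubfield L)) L (IsCMField.complexConj L) 2 Jstar)),
        (rationalToFinAdelic (↥(maximalRealSubfield L)) L (IsCMField.complexConj L) 2 Jstar δ * u)⁻¹ * gs q ∈ Kstar.1.1)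
    (P : ShimuraSetGS L Jstar τ Kstar.1.1) :
    letI : Algebra L ℂ := τ.toAlgebra
    AlgPoints.map ιc (AlgPoints.baseChangeEquiv τ (Sstar.M.obj Kstar) ((Sstar.pts Kstar).symm P)) =
      AlgPoints.baseChangeEquiv τ (S.M.obj K)
        ((S.pts K).symm (ShimuraSetGS.embPoints L H τ T hT Jstar Jperp B ha hB hτa hτa' Kstar.1.1 K.1.1 hK P)) := by
  letI : Algebra L ℂ := τ.toAlgebra
  obtain ⟨v, hv, u, rfl⟩ := ShimuraSetGS.mk_surjective L Jstar τ Kstar.1.1 P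
  -- the point `[v, uK⋆]` lies on the piece of some `q`: `[v, uK⋆] = [δ^τ v, g⋆_q K⋆]`
  refine (hgs u).elim fun q hq => hq.elim fun δ hδ => ?_
  have hx : ((ratToGLℂ L Jstar τ δ : GL (Fin 2) ℂ) : Matrix (Fin 2) (Fin 2) ℂ) *ᵥ v ∈ negCone (Jstar.map τ) := by
    have h := smul_ratToGLℂ_mulVec_mem_negCone (L := L) (Jstar := Jstar) (τ := τ) δ one_ne_zero hv
    rwa [one_smul] at h
  rewrite [ShimuraSetGS.mk_eq_mk_mulVec_rep v hv u (gs q) δ hδ hx]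
  exact Sstar.map_glued_mk_rep_eq_embPoints S Jperp B ha hB hτa hτa' hK ιs Bs gs hBs ι Bq gq hBq hιq q' γ hγ f hf ιc hιc q _ hx

end Glue

/-! ### §5. The embedding of the complex fibres -/

section Assembly

variable (Sstar : RecordSystemGS L Jstar τ K₀) (S : RecordSystem L H τ T hT K₀')
  (Jperp : Matrix (Fin 1) (Fin 1) L) (B : GL (Fin 3) L) {a : L} (ha : a ≠ 0)
  (hB : formCongr ((IsCMField.complexConj L : L ≃ₐ[↥(maximalRealSubfield L)] L) : L →+* L) B (a • H) = finSum 2 1 Jstar Jperp)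
  (hτa : 0 < (τ a).re) (hτa' : (τ a).im = 0)
  (Kstar : C5.SmallLevel K₀) (K : C5.SmallLevel K₀') (hK : Kstar.1.1.map (φGS L Jstar Jperp H B ha hB) ≤ K.1.1)

/-- **[Milne2005ShimuraVarieties] §13 p. 118 L25–26 / [Liu2021] Thm. 4.15 proof («the morphism `Sh(G⋆, h⋆) → Sh(G, h)`») for the two
records, COMPLEX HALF**: for the curve record `S⋆` (source, `U(J⋆)`), the rank-3 record `S` (target, `U(H)`), a frame
`ᵗ(cB)·(a·H)·B = J⋆ ⊕ J⊥` (`τ a` a positive real) and levels with `φGS(K⋆) ≤ K`, there is a morphism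
`ι_ℂ : (M⋆_{K⋆})_τ → (M_K)_τ` over `ℂ` of the complex fibres acting on complex points as the sub-ball inclusion ★
`ShimuraSetGS.embPoints`, `[v, uK⋆] ↦ [𝔹(B^τ(v ⊕ 0)), φGS(u)K]` (points read through the records՚ `pts` and `AlgPoints.baseChangeEquiv τ`)
— the hypothesis `hC` of ★ `RecordSystemGS.embeddingDefinedOver_of_complex`, token for token.  Built piece by piece on `S⋆.pieces` (disc
quotients) into `S.pieces` (ball quotients) from `exists_hom_piece_subBall`, glued by `Cofan.IsColimit.desc`, with the point formula
`map_glued_eq_embPoints`. [cite: Milne2005ShimuraVarieties, §13 p. 118 L21–28; Lemma 5.13 p. 57]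
[cite: Liu2021, Thm. 4.15 proof (FJcycle.tex l. 2193–2208)] [cite: Deligne1979ShimuraVarieties, 2.1.2–2.1.4] [cite: Arapura2012, §15.4 Cor. 15.4.6] -/
theorem RecordSystemGS.exists_embeddingComplex :
    letI : Algebra L ℂ := τ.toAlgebra
    ∃ ιc : (Motives.baseChangeHom τ).obj (Sstar.M.obj Kstar) ⟶ (Motives.baseChangeHom τ).obj (S.M.obj K),
      ∀ P : ShimuraSetGS L Jstar τ Kstar.1.1,
        AlgPoints.map ιc (AlgPoints.baseChangeEquiv τ (Sstar.M.obj Kstar) ((Sstar.pts Kstar).symm P)) =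
          AlgPoints.baseChangeEquiv τ (S.M.obj K)
            ((S.pts K).symm (ShimuraSetGS.embPoints L H τ T hT Jstar Jperp B ha hB hτa hτa' Kstar.1.1 K.1.1 hK P)) := by
  letI : Algebra L ℂ := τ.toAlgebra
  classical
  obtain ⟨gs, hgs, Xs, ιs, hcols, Bs, hBs⟩ := Sstar.pieces Kstar
  obtain ⟨gq, hgq, X, ι, hcol, Bq, hBq⟩ := S.pieces K
  -- for each source piece `q`: the target class `q'` of `φGS(g⋆_q)` and a bookkeeper `γ_q` with `g_{q'}⁻¹ γ_{q,f} φGS(g⋆_q) ∈ K`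
  let q' : orbitRel.Quotient (rational (↥(maximalRealSubfield L)) L (IsCMField.complexConj L) 2 Jstar)
      (CosetSpace (rationalToFinAdelic (↥(maximalRealSubfield L)) L (IsCMField.complexConj L) 2 Jstar) Kstar.1.1) →
      orbitRel.Quotient (rational (↥(maximalRealSubfield L)) L (IsCMField.complexConj L) 3 H)
        (CosetSpace (rationalToFinAdelic (↥(maximalRealSubfield L)) L (IsCMField.complexConj L) 3 H) K.1.1) :=
    fun q => Quotient.mk'' (CosetSpace.pt (rationalToFinAdelic (↥(maximalRealSubfield L)) L (IsCMField.complexConj L) 3 H) K.1.1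
      (φGS L Jstar Jperp H B ha hB (gs q)))
  have hrep : ∀ q, ∃ γ : rational (↥(maximalRealSubfield L)) L (IsCMField.complexConj L) 3 H,
      (gq (q' q))⁻¹ * (rationalToFinAdelic (↥(maximalRealSubfield L)) L (IsCMField.complexConj L) 3 H γ *
        φGS L Jstar Jperp H B ha hB (gs q)) ∈ K.1.1 := by
    intro q
    obtain ⟨γ, hγ⟩ := exists_rational_smul_rep_mem (F := ↥(maximalRealSubfield L)) (c := IsCMField.complexConj L) hgq
      (φGS L Jstar Jperp H B ha hB (gs q))
    refine ⟨γ, ?_⟩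
    have h := K.1.1.inv_mem hγ
    rwa [_root_.mul_inv_rev, inv_inv] at h
  choose γ hγ using hrep
  -- the piece morphisms `Y_q ⟶ X_{q'}`, `unif⋆_q v ↦ unif_{q'} ((γ_q B)^τ (v ⊕ 0))`
  have hpiece : ∀ q, ∃ f : Xs q ⟶ X (q' q), ∀ v ∈ negCone (Jstar.map τ),
      AlgPoints.map f ((Bs q).unif v) = (Bq (q' q)).unif (frameEmbNeg τ ((γ q : GL (Fin 3) L) * B) v) := fun q =>
    exists_hom_piece_subBall Jperp B ha hB hτa hτa' hK (Bq (q' q)) (gq (q' q)) (Bs q) (gs q) (γ q) (hBq (q' q)).1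
      (hBq (q' q)).2.1 (hBs q).1 (hBs q).2.1 (hγ q)
  choose f hf using hpiece
  -- glue along the source coproduct; the point formula is `map_glued_eq_embPoints`
  exact ⟨Cofan.IsColimit.desc hcols fun q => f q ≫ ι (q' q),
    Sstar.map_glued_eq_embPoints S Jperp B ha hB hτa hτa' hK ιs Bs gs (fun q => (hBs q).2.2)
      ι Bq gq (fun r => (hBq r).1) (fun r => (hBq r).2.2) q' γ hγ f hf _ (fun q => Cofan.IsColimit.fac hcols _ q)
      (fun u => ⟨_, exists_rational_smul_rep_mem (F := ↥(maximalRealSubfield L)) (c := IsCMField.complexConj L) hgs u⟩)⟩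

end Assembly

end Literature.AlgebraicGeometry.ShimuraVarieties.UnitaryCanonicalModel

end
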